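/-
Copyright (c) 2026 the pub-hodgecm-mathlib formalisation cell (harness21).  Prover seat hodgecm-mathlib-K2E3-p06 (g6) (E3 hand lent to L1; LEAD F0P6-plan (g14) BATCH #166 (2);
desk K2E3-p14 (g9) ruling 2026-09-04T23:48:15Z «K2E3-p06 → W-FE-2c RAMIFIED ν»), Track B «K2-LIT» ∕ hLiu418 = stmt-HodgeConjecture-24832: U1-CT-ind stage 3, brick B2a′
(the rank-one ψ-Whittaker functional equation), file W-FE-2c — the Γ-FACTOR LETTER at a RAMIFIED character `ν` (sibling of ★ p863232 `K2LiuTwistedGammaFactorLetter`,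
the unramified letter, by LH7-p06 (g2)).  THEOREMS ONLY (no `def`∕`instance`∕notation∕`sorry`).
-/
import Summits.HodgeConjecture.HodgeConjecture.Theorems.K2LiuTwistedGammaFactorLetter   -- ★ p863232 (W-FE-2b): §1 free inversion, §2 `setIntegral_compl_tail_mul_addChar_inv_eq` (brings ★ `TateGaussSums` = `TateDirect`, ★ `LocalFieldHaarBalls`)
import Literature.NumberTheory.Automorphic.TateLocalFunctionalEquation                 -- ★ `gaussSum_shell_ne_zero` (Tate's Lemma 2.4.3 (1): the Gauss sum has absolute value `1`)
import HarnessLib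

/-!
# Crux `HLiu418`, organ U1-CT-ind STAGE 3 («U1-glob»), brick B2a′, file W-FE-2c: THE Γ-FACTOR LETTER AT A RAMIFIED CHARACTER —
# `∫_{x ∉ 𝔭^N} T(x) ψ(c x⁻¹) dμ(x) = C₀ · (q^{2−e})^{m′−c_ν} · G_c`, `G_c = ∫_{𝔭^{m′−c_ν} ∖ 𝔭^{m′−c_ν+1}} ψ(cy) ν̃(y) dμ(y) ≠ 0` (`m′ = m_ψ − j_c`; only the Gauss shell survives)
# [Tate1950 §2.5 (ramified case), Lemma 2.4.3; CasselmanShalika1980 §4; BushnellHenniart2006 §23.5]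

Cell `hodgecm-mathlib`, crux item hLiu418 = `stmt-HodgeConjecture-24832`; squad K2, strike line L1, LEAD F0P6-plan (g14); desk K2E3-p14 (g9) + K2Liu-p13 (g4);
prover K2E3-p06 (g6).  Lane `--supports stmt-HodgeConjecture-24832 --as helper` (count-neutral).  GROUP-FREE, any non-archimedean local field `F`, additive Haar `μ`.

THE POINT.  ★ W-FE-1b (`K2LiuRankOneWhittakerFunctionalEquation.twistedHeadSum_intertwined_eq_mul`) moves the intertwining operator through the ψ_σ-twisted head sum at the
price of the scalar `Γ = ∫_{x ∉ 𝔭^N} T(x) ψ(σκ x⁻¹) dμ(x)`, `T = C₀ ν(·)⁻¹‖·‖^{−e}`; ★ W-FE-3 (`K2LiuRankOneWhittakerFECentre`) continues to the centre through ONE evaluation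
letter `(Γt, hΓ : Γ = L(e−1,ν)·Γt, hΓreg, hΓ0 : Γt(centre) ≠ 0)`; ★ W-FE-2b = p863232 evaluates it for UNRAMIFIED unitary `ν`.  THIS FILE is the RAMIFIED sibling: `ν` unitary
of EXACT conductor exponent `c_ν ≥ 1` (`ν|U^{c_ν} = 1`, `ν|U^{b} ≠ 1` for `b < c_ν`), `ψ` continuous of conductor exponent `m_ψ`, `‖c‖ = q^{−j_c}`, `m′ := m_ψ − j_c` (the conductor
exponent of `ψ(c·)`, ★ `AddChar.HasConductorExp.mulShift`), threshold `1 − N ≤ m′ − c_ν` (the ball `𝔭^{1−N}` contains the Gauss shell; W-FE-1: `N = M + k_κ + 1`, `M` large).  By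
★ p863232 §2 the Γ-integral is `C₀ ∫_{𝔭^{1−N}∖0} ψ(cy) ν̃(y) ‖y‖^{e−2} dμ(y)`, and by Tate's ramified computation (★ `TateDirect.integral_ball_addChar_mul_extend_cpow_of_ramified`:
the shells above the Gauss shell die by the conductor of `ν`, the shells below it by the conductor of `ψ(c·)`) only the shell `‖y‖ = q^{−(m′−c_ν)}` survives:
  **`Γ = C₀ · (q^{−(e−2)})^{m′−c_ν} · G_c`**, `G_c = ∫_{𝔭^{m′−c_ν} ∖ 𝔭^{m′−c_ν+1}} ψ(cy) ν̃(y) dμ(y)` INDEPENDENT of `e` —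
so here `L(e−1, ν) = 1`, `Γt = Γ` is a Laurent MONOMIAL in `q^{−e}` (regular everywhere), and `Γt ≠ 0` at every `e` as soon as `C₀ ≠ 0`, because **`G_c ≠ 0`**: `G_c = q^{−(m′−c_ν)} ·
∫_{A_{m′−c_ν}} ψ(c u) ν(u) dμ^×(u)` (the shell bridge `dμ^× = ‖x‖⁻¹dμ`, ★ `integral_unitsMeasure`) and the multiplicative Gauss sum is non-zero by ★ `gaussSum_shell_ne_zero` (Tate's
Lemma 2.4.3 (1), `|ρ₀(c)| = 1`).
* §0 `continuous_of_trivial_on_unitFiltration` (a character trivial on some `U^n` is continuous), `continuous_addChar_mulShift`, `isContinuousNontrivial_mulShift`;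
* §1 the shell bridge `setIntegral_units_shell_eq` (`∫_{‖u‖=q^{−k}} G dμ^× = q^k ∫_{𝔭^k∖𝔭^{k+1}} G dμ`);
* §2 `integral_ball_addChar_mul_extend_cpow_of_ramified` (the twisted ramified ball integral: `(q^{−w})^{m′−c_ν} · G_c` for `n ≤ m′ − c_ν`, `−1 < re w`);
* §3 THE LETTER `setIntegral_compl_tail_mul_addChar_inv_eq_gaussShell` (+ W-FE-1's bytes `…_mul_inv_…` with `c = σκ`);
* §4 `gaussIntegral_shell_ne_zero` (`G_c ≠ 0`) and `gammaRamified_ne_zero` (`C₀ ≠ 0 ⇒ Γ ≠ 0` at every `e`).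
References: [Tate1950] J. Tate (1950), §2.5 (ramified computation "`ζ(f_n, c_n|·|^s) = N𝔭^{(d+n)s}∫_{A_{−d−n}} …`"), Lemma 2.4.3; [CasselmanShalika1980] W. Casselman, J. Shalika,
Compositio Math. 41 (1980), §4; [BushnellHenniart2006] C. J. Bushnell, G. Henniart (2006), §1.7 Prop., §23.5; [GanTakeda2011SiegelWeil] W. T. Gan, S. Takeda (2011), §7 Lemma 7.4.
HONEST LABEL.  Count-neutral helper: `HC_CM` is proved only modulo the 7 printed citations (2 remaining named inputs: hLiu418 = `stmt-HodgeConjecture-24832`,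
h413 = `stmt-HodgeConjecture-24833`) until rung 0 closes; B2a′ OPEN modulo the `K_w` repackaging of the two Γ-letters (unramified ★ p863232, ramified = this file) into W-FE-3's
`(Γt, hΓ, hΓreg, hΓ0)` and the `U(2,2)_v` instantiation; this file closes no socket.
-/

set_option autoImplicit false
set_option linter.dupNamespace false -- the mandated namespace repeats `HodgeConjecture.HodgeConjecture`

noncomputable section

open MeasureTheory Filter Topology Set
open scoped NNReal ENNReal
open Literature.NumberTheory.GaloisRepresentations.IsNonarchimedeanLocalField
open Literature.NumberTheory.Automorphic Literature.NumberTheory.Automorphic.LocalFieldHaar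
open Summit.HodgeConjecture.HodgeConjecture.Cruxes.HLiu418.K2LiuTwistedGammaFactorLetter (setIntegral_compl_tail_mul_addChar_inv_eq)

namespace Summit.HodgeConjecture.HodgeConjecture.Cruxes.HLiu418.K2LiuTwistedGammaFactorLetterRamified

variable {F : Type*} [Field F] [ValuativeRel F] [TopologicalSpace F] [IsNonarchimedeanLocalField F]

/-! ## §0 Continuity of a character with a conductor; the dilated additive character `ψ(c·)` -/

/-- a character `ν : Fˣ →* ℂˣ` trivial on SOME `U^n` is continuous (`U^n ∈ 𝓝 1`, ★ `unitFiltration_mem_nhds_one`). [cite: Tate1950, §2.3] [cite: BushnellHenniart2006, §1.8] -/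
theorem continuous_of_trivial_on_unitFiltration (ν : Fˣ →* ℂˣ) {n : ℕ} (hνc : ∀ u ∈ unitFiltration F n, ν u = 1) : Continuous ν := by
  refine continuous_of_continuousAt_one ν ?_
  refine (continuousAt_const : ContinuousAt (fun _ : Fˣ => (1 : ℂˣ)) 1).congr ?_
  filter_upwards [unitFiltration_mem_nhds_one (F := F) n] with u hu
  exact (hνc u hu).symm

omit [ValuativeRel F] [IsNonarchimedeanLocalField F] in
/-- `ψ(c·)` is continuous if `ψ` is. [folklore] -/
theorem continuous_addChar_mulShift [IsTopologicalRing F] {ψ : AddChar F Circle} (hψ : Continuous ψ) (c : F) : Continuous (ψ.mulShift c) :=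
  (hψ.comp (continuous_const.mul continuous_id)).congr fun _ => (AddChar.mulShift_apply).symm

/-- `ψ(c·)` is continuous and non-trivial for `ψ` continuous with a conductor exponent and `c ≠ 0` (its conductor exponent is `m_ψ − j_c`, ★ `AddChar.HasConductorExp.mulShift`).
[cite: BushnellHenniart2006, §1.7, Proposition] -/
theorem isContinuousNontrivial_mulShift {ψ : AddChar F Circle} (hψ : Continuous ψ) {mψ : ℤ} (hmψ : ψ.HasConductorExp mψ) {c : F} {jc : ℤ}
    (hc : normAbs F c = (residueFieldCard F : ℝ≥0)⁻¹ ^ jc) : (ψ.mulShift c).IsContinuousNontrivial := by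
  haveI : IsTopologicalRing F := inferInstance
  refine ⟨continuous_addChar_mulShift hψ c, fun h0 => ?_⟩
  obtain ⟨x, -, hx⟩ := (hmψ.mulShift hc).2
  exact hx (by rw [h0, AddChar.zero_apply])

/-! ## §1 The shell bridge `dμ^× = ‖x‖⁻¹ dμ` -/

variable [MeasurableSpace F] [BorelSpace F] (μ : Measure F) [μ.IsAddHaarMeasure]

/-- **THE SHELL BRIDGE**: on the shell `‖u‖ = q^{−k}`, `dμ^× = q^k dμ`: `∫_{u ∈ Fˣ, ‖u‖ = q^{−k}} G(u) dμ^×(u) = q^k · ∫_{𝔭^k ∖ 𝔭^{k+1}} G dμ` (`μ^× = (‖·‖⁻¹μ)|_{Fˣ}`,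
★ `integral_unitsMeasure`; the additive shell is ★ `mem_shell_iff`). [cite: Tate1950, §2.3] -/
theorem setIntegral_units_shell_eq (G : F → ℂ) (k : ℤ) :
    ∫ u in {u : Fˣ | normAbs F (u : F) = (residueFieldCard F : ℝ≥0)⁻¹ ^ k}, G (u : F)
        ∂(Measure.comap ((↑) : Fˣ → F) (μ.withDensity fun x => (((normAbs F x)⁻¹ : ℝ≥0) : ℝ≥0∞))) =
      ((residueFieldCard F : ℝ) ^ k : ℝ) * ∫ x in primePowBall F k \ primePowBall F (k + 1), G x ∂μ := by
  set S : Set F := primePowBall F k \ primePowBall F (k + 1) with hS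
  have hSm : MeasurableSet S := (measurableSet_primePowBall k).diff (measurableSet_primePowBall (k + 1))
  have hpre : {u : Fˣ | normAbs F (u : F) = (residueFieldCard F : ℝ≥0)⁻¹ ^ k} = ((↑) : Fˣ → F) ⁻¹' S := by
    ext u
    rw [Set.mem_setOf_eq, Set.mem_preimage, hS, mem_shell_iff]
  rw [hpre, ← integral_indicator (measurableEmbedding_unitsVal.measurable hSm)]
  have hind : ∀ u : Fˣ, (((↑) : Fˣ → F) ⁻¹' S).indicator (fun u : Fˣ => G (u : F)) u = S.indicator G (u : F) := by
    intro u
    by_cases hu : (u : F) ∈ S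
    · rw [Set.indicator_of_mem (show u ∈ ((↑) : Fˣ → F) ⁻¹' S from hu), Set.indicator_of_mem hu]
    · rw [Set.indicator_of_notMem (show u ∉ ((↑) : Fˣ → F) ⁻¹' S from hu), Set.indicator_of_notMem hu]
  simp_rw [hind]
  rw [integral_unitsMeasure μ (S.indicator G), ← integral_indicator hSm, ← integral_const_mul]
  refine integral_congr_ae (Filter.Eventually.of_forall fun x => ?_)
  beta_reduce
  by_cases hx : x ∈ S
  · have hxn : normAbs F x = (residueFieldCard F : ℝ≥0)⁻¹ ^ k := mem_shell_iff.1 hx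
    rw [Set.indicator_of_mem hx, Complex.real_smul, hxn, NNReal.coe_zpow, NNReal.coe_inv, NNReal.coe_natCast, inv_zpow, inv_inv]
  · rw [Set.indicator_of_notMem hx, smul_zero, mul_zero]

/-! ## §2 The twisted ramified ball integral: only the Gauss shell survives -/

/-- **THE BALL INTEGRAL AT A RAMIFIED CHARACTER (twisted by `ψ(c·)`).**  `ν` unitary of exact conductor exponent `c_ν ≥ 1`, `ψ` continuous of conductor exponent `m_ψ`, `‖c‖ = q^{−j_c}`,
`m′ = m_ψ − j_c`, `−1 < re w`, and a ball `𝔭^n` with `n ≤ m′ − c_ν`: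
`∫_{𝔭^n ∖ 0} ψ(cy)·ν̃(y)·‖y‖^w dμ(y) = (q^{−w})^{m′−c_ν} · ∫_{𝔭^{m′−c_ν} ∖ 𝔭^{m′−c_ν+1}} ψ(cy)·ν̃(y) dμ(y)` — the shells `k > m′ − c_ν` die by the conductor of `ν`, the shells
`n ≤ k < m′ − c_ν` by the conductor of `ψ(c·)` (★ `TateDirect.integral_ball_addChar_mul_extend_cpow_of_ramified` for the dilated character `ψ(c·)`, ★ `AddChar.HasConductorExp.mulShift`).
[cite: Tate1950, §2.5] [cite: BushnellHenniart2006, §23.5] -/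
theorem integral_ball_addChar_mul_extend_cpow_of_ramified (ν : Fˣ →* ℂˣ) (hν : ∀ x, ‖((ν x : ℂˣ) : ℂ)‖ = 1) {cν : ℕ} (hc1 : 1 ≤ cν)
    (hνc : ∀ u ∈ unitFiltration F cν, ν u = 1) (hνmin : ∀ b < cν, ∃ u ∈ unitFiltration F b, ν u ≠ 1)
    {ψ : AddChar F Circle} (hψ : Continuous ψ) {mψ : ℤ} (hmψ : ψ.HasConductorExp mψ) {c : F} {jc : ℤ} (hc : normAbs F c = (residueFieldCard F : ℝ≥0)⁻¹ ^ jc)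
    {w : ℂ} (hw : -1 < w.re) {n : ℤ} (hn : n ≤ mψ - jc - cν) :
    ∫ y in primePowBall F n \ {0}, ((ψ (c * y)) : ℂ) * Function.extend ((↑) : Fˣ → F) (fun u => ((ν u : ℂˣ) : ℂ)) 0 y * (((normAbs F y : ℝ≥0) : ℝ) : ℂ) ^ w ∂μ =
      ((residueFieldCard F : ℂ) ^ (-w)) ^ (mψ - jc - cν) *
        ∫ y in primePowBall F (mψ - jc - cν) \ primePowBall F (mψ - jc - cν + 1),
          ((ψ (c * y)) : ℂ) * Function.extend ((↑) : Fˣ → F) (fun u => ((ν u : ℂˣ) : ℂ)) 0 y ∂μ := by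
  -- `ν` as a quasi-character: unitary (exponent `0`), of conductor exponent `cν`
  obtain ⟨νq, hνq⟩ : ∃ νq : QuasiChar F, ∀ x, νq x = ν x := ⟨⟨ν, continuous_of_trivial_on_unitFiltration ν hνc⟩, fun _ => rfl⟩
  have hτ : νq.HasExponent 0 := fun x => by rw [Real.rpow_zero, hνq]; exact hν x
  have hcq : νq.HasConductorExp cν :=
    ⟨fun u hu => by rw [hνq]; exact hνc u hu, fun b hb => by
      obtain ⟨u, hu, hne⟩ := hνmin b hb
      exact ⟨u, hu, by rw [hνq]; exact hne⟩⟩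
  have hext : Function.extend ((↑) : Fˣ → F) (fun u => ((νq u : ℂˣ) : ℂ)) 0 = Function.extend ((↑) : Fˣ → F) (fun u => ((ν u : ℂˣ) : ℂ)) 0 := by
    congr 1
    funext u
    rw [hνq]
  have h := TateDirect.integral_ball_addChar_mul_extend_cpow_of_ramified μ (continuous_addChar_mulShift hψ c) (hmψ.mulShift hc) hcq hc1 hτ w
    (by linarith) (mψ - jc - n)
  rw [show mψ - jc - (mψ - jc - n) = n by ring, if_pos (by omega), hext, TateDirect.natCast_cpow_neg_intCast_mul] at h
  have hfun : ∀ y : F, (((ψ.mulShift c) y : ℂ)) = ((ψ (c * y)) : ℂ) := fun y => by rw [AddChar.mulShift_apply]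
  simp_rw [hfun] at h
  exact h

/-! ## §3 THE LETTER at a ramified character -/

/-- **THE Γ-FACTOR OF THE RANK-ONE ψ-WHITTAKER FUNCTIONAL EQUATION AT A RAMIFIED CHARACTER.**  In W-FE-1's letters (`T x = C₀ ν(x)⁻¹ ‖x‖^{−e}` on units, `1 < re e`), with `ν`
unitary of exact conductor exponent `c_ν ≥ 1`, `ψ` continuous of conductor exponent `m_ψ`, `‖c‖ = q^{−j_c}`, `m′ = m_ψ − j_c`, and the threshold `1 − N ≤ m′ − c_ν` (W-FE-1: `c = σκ`,
`N = M + k_κ + 1`):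
**`∫_{x ∉ 𝔭^N} T(x) ψ(c x⁻¹) dμ(x) = C₀ · (q^{−(e−2)})^{m′−c_ν} · G_c`**, `G_c = ∫_{𝔭^{m′−c_ν} ∖ 𝔭^{m′−c_ν+1}} ψ(cy) ν̃(y) dμ(y)` — NO `L`-factor (`L(e−1,ν) = 1` at a ramified `ν`):
`Γ = Γt` is a Laurent monomial in `q^{−e}` times the `e`-independent Gauss integral `G_c` (§4: `G_c ≠ 0`). (★ p863232 §2 `setIntegral_compl_tail_mul_addChar_inv_eq` + §2 above at
`w = e − 2`.) [cite: Tate1950, §2.5] [cite: CasselmanShalika1980, §4] [cite: GanTakeda2011SiegelWeil, §7 Lemma 7.4] -/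
theorem setIntegral_compl_tail_mul_addChar_inv_eq_gaussShell (ν : Fˣ →* ℂˣ) (hν : ∀ x, ‖((ν x : ℂˣ) : ℂ)‖ = 1) {cν : ℕ} (hc1 : 1 ≤ cν)
    (hνc : ∀ u ∈ unitFiltration F cν, ν u = 1) (hνmin : ∀ b < cν, ∃ u ∈ unitFiltration F b, ν u ≠ 1)
    (C₀ : ℂ) {e : ℂ} (he : 1 < e.re) (T : F → ℂ) (hT : ∀ x : Fˣ, T x = C₀ * (((ν x)⁻¹ : ℂˣ) : ℂ) * (((normAbs F (x : F) : ℝ≥0) : ℝ) : ℂ) ^ (-e))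
    {ψ : AddChar F Circle} (hψ : Continuous ψ) {mψ : ℤ} (hmψ : ψ.HasConductorExp mψ) {c : F} {jc : ℤ} (hc : normAbs F c = (residueFieldCard F : ℝ≥0)⁻¹ ^ jc)
    {N : ℤ} (hN : 1 - N ≤ mψ - jc - cν) :
    ∫ x in (primePowBall F N)ᶜ, T x * ((ψ (c * x⁻¹)) : ℂ) ∂μ =
      C₀ * ((residueFieldCard F : ℂ) ^ (-(e - 2))) ^ (mψ - jc - cν) *
        ∫ y in primePowBall F (mψ - jc - cν) \ primePowBall F (mψ - jc - cν + 1),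
          ((ψ (c * y)) : ℂ) * Function.extend ((↑) : Fˣ → F) (fun u => ((ν u : ℂˣ) : ℂ)) 0 y ∂μ := by
  rw [setIntegral_compl_tail_mul_addChar_inv_eq μ ν C₀ e T hT ψ c N,
    integral_ball_addChar_mul_extend_cpow_of_ramified μ ν hν hc1 hνc hνmin hψ hmψ hc (w := e - 2) (by simp; linarith) hN, mul_assoc]

/-- **W-FE-1's BYTES** (`c = σκ` written as `ψ (σ * (κ * x⁻¹))`, as in ★ `twistedHeadSum_intertwined_eq_mul`'s right-hand factor): the same Gauss-shell form.
[cite: Tate1950, §2.5] [cite: CasselmanShalika1980, §4] -/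
theorem setIntegral_compl_tail_mul_addChar_mul_inv_eq_gaussShell (ν : Fˣ →* ℂˣ) (hν : ∀ x, ‖((ν x : ℂˣ) : ℂ)‖ = 1) {cν : ℕ} (hc1 : 1 ≤ cν)
    (hνc : ∀ u ∈ unitFiltration F cν, ν u = 1) (hνmin : ∀ b < cν, ∃ u ∈ unitFiltration F b, ν u ≠ 1)
    (C₀ : ℂ) {e : ℂ} (he : 1 < e.re) (T : F → ℂ) (hT : ∀ x : Fˣ, T x = C₀ * (((ν x)⁻¹ : ℂˣ) : ℂ) * (((normAbs F (x : F) : ℝ≥0) : ℝ) : ℂ) ^ (-e))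
    {ψ : AddChar F Circle} (hψ : Continuous ψ) {mψ : ℤ} (hmψ : ψ.HasConductorExp mψ) (σ κ : F) {jc : ℤ} (hc : normAbs F (σ * κ) = (residueFieldCard F : ℝ≥0)⁻¹ ^ jc)
    {N : ℤ} (hN : 1 - N ≤ mψ - jc - cν) :
    ∫ x in (primePowBall F N)ᶜ, T x * ((ψ (σ * (κ * x⁻¹))) : ℂ) ∂μ =
      C₀ * ((residueFieldCard F : ℂ) ^ (-(e - 2))) ^ (mψ - jc - cν) *
        ∫ y in primePowBall F (mψ - jc - cν) \ primePowBall F (mψ - jc - cν + 1),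
          ((ψ (σ * κ * y)) : ℂ) * Function.extend ((↑) : Fˣ → F) (fun u => ((ν u : ℂˣ) : ℂ)) 0 y ∂μ := by
  simp_rw [← mul_assoc σ κ]
  exact setIntegral_compl_tail_mul_addChar_inv_eq_gaussShell μ ν hν hc1 hνc hνmin C₀ he T hT hψ hmψ hc hN

/-! ## §4 The Gauss integral on the critical shell does not vanish -/

/-- **`G_c ≠ 0`**: `∫_{𝔭^{m′−c_ν} ∖ 𝔭^{m′−c_ν+1}} ψ(cy) ν̃(y) dμ(y) ≠ 0` for `ν` unitary of exact conductor exponent `c_ν ≥ 1`, `ψ` continuous of conductor exponent `m_ψ`, `‖c‖ = q^{−j_c}`,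
`m′ = m_ψ − j_c`: by the shell bridge (§1) it is `q^{−(m′−c_ν)}` times the multiplicative Gauss sum `∫_{A_{m′−c_ν}} ψ(cu) ν(u) dμ^×(u)` of the dilated character `ψ(c·)` (conductor
exponent `m′`) against `ν = (ν⁻¹)⁻¹`, which is non-zero by ★ `gaussSum_shell_ne_zero` (Tate's Lemma 2.4.3 (1): `ρ₀(c)ρ₀(ĉ) = c(−1)`, `|ρ₀| = 1`). [cite: Tate1950, §2.5, Lemma 2.4.3]
[cite: BushnellHenniart2006, §23.5] -/
theorem gaussIntegral_shell_ne_zero (ν : Fˣ →* ℂˣ) {cν : ℕ} (hc1 : 1 ≤ cν)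
    (hνc : ∀ u ∈ unitFiltration F cν, ν u = 1) (hνmin : ∀ b < cν, ∃ u ∈ unitFiltration F b, ν u ≠ 1)
    {ψ : AddChar F Circle} (hψ : Continuous ψ) {mψ : ℤ} (hmψ : ψ.HasConductorExp mψ) {c : F} {jc : ℤ} (hc : normAbs F c = (residueFieldCard F : ℝ≥0)⁻¹ ^ jc) :
    ∫ y in primePowBall F (mψ - jc - cν) \ primePowBall F (mψ - jc - cν + 1),
        ((ψ (c * y)) : ℂ) * Function.extend ((↑) : Fˣ → F) (fun u => ((ν u : ℂˣ) : ℂ)) 0 y ∂μ ≠ 0 := by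
  set μx : Measure Fˣ := Measure.comap ((↑) : Fˣ → F) (μ.withDensity fun x => (((normAbs F x)⁻¹ : ℝ≥0) : ℝ≥0∞)) with hμx
  haveI : BorelSpace Fˣ := Units.borelSpace
  haveI : μx.IsHaarMeasure := isHaarMeasure_unitsMeasure μ
  -- `ν` as a quasi-character of conductor exponent `cν`; so is `ν⁻¹`
  obtain ⟨νq, hνq⟩ : ∃ νq : QuasiChar F, ∀ x, νq x = ν x := ⟨⟨ν, continuous_of_trivial_on_unitFiltration ν hνc⟩, fun _ => rfl⟩
  have hcq : νq.HasConductorExp cν :=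
    ⟨fun u hu => by rw [hνq]; exact hνc u hu, fun b hb => by
      obtain ⟨u, hu, hne⟩ := hνmin b hb
      exact ⟨u, hu, by rw [hνq]; exact hne⟩⟩
  have hcq' : (νq⁻¹ : QuasiChar F).HasConductorExp cν := (TateDirect.hasConductorExp_inv_iff νq).2 hcq
  -- Tate: the multiplicative Gauss sum of `ψ(c·)` (conductor exponent `mψ − jc`) against `(ν⁻¹)⁻¹ = ν` on the shell `A_{mψ−jc−cν}` is non-zero
  have hG := gaussSum_shell_ne_zero μ μx (isContinuousNontrivial_mulShift hψ hmψ hc) (hmψ.mulShift hc) hcq' hc1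
  have hinv : (νq⁻¹ : QuasiChar F)⁻¹ = νq := inv_inv νq
  rw [hinv] at hG
  -- the bridge to the additive shell
  have hb := setIntegral_units_shell_eq μ (fun x => ((ψ (c * x)) : ℂ) * Function.extend ((↑) : Fˣ → F) (fun u => ((ν u : ℂˣ) : ℂ)) 0 x) (mψ - jc - cν)
  have hcongr : ∫ u in {u : Fˣ | normAbs F (u : F) = (residueFieldCard F : ℝ≥0)⁻¹ ^ (mψ - jc - (cν : ℤ))},
      ((ψ (c * (u : F))) : ℂ) * Function.extend ((↑) : Fˣ → F) (fun u => ((ν u : ℂˣ) : ℂ)) 0 (u : F) ∂μx =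
      ∫ u in {u : Fˣ | normAbs F (u : F) = (residueFieldCard F : ℝ≥0)⁻¹ ^ (mψ - jc - (cν : ℤ))},
        (((ψ.mulShift c) (u : F) : ℂ)) * ((νq u : ℂˣ) : ℂ) ∂μx := by
    refine setIntegral_congr_fun (measurableSet_normAbs_shell _) fun u _ => ?_
    rw [AddChar.mulShift_apply, hνq, Units.val_injective.extend_apply]
  rw [hcongr] at hb
  intro h0
  rw [h0, mul_zero] at hb
  exact hG hb

/-- **`Γ ≠ 0` AT EVERY `e` (ramified `ν`)**: `C₀ · (q^{−(e−2)})^{m′−c_ν} · G_c ≠ 0` as soon as `C₀ ≠ 0` — in particular at the centre of the rank-one step: at a RAMIFIED place the scalar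
of the ψ-Whittaker functional equation has neither zero nor pole. [cite: Tate1950, §2.5, Lemma 2.4.3] [cite: GanTakeda2011SiegelWeil, §7 Lemma 7.4] -/
theorem gammaRamified_ne_zero (ν : Fˣ →* ℂˣ) {cν : ℕ} (hc1 : 1 ≤ cν)
    (hνc : ∀ u ∈ unitFiltration F cν, ν u = 1) (hνmin : ∀ b < cν, ∃ u ∈ unitFiltration F b, ν u ≠ 1)
    {ψ : AddChar F Circle} (hψ : Continuous ψ) {mψ : ℤ} (hmψ : ψ.HasConductorExp mψ) {c : F} {jc : ℤ} (hc : normAbs F c = (residueFieldCard F : ℝ≥0)⁻¹ ^ jc)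
    {C₀ : ℂ} (hC₀ : C₀ ≠ 0) (e : ℂ) :
    C₀ * ((residueFieldCard F : ℂ) ^ (-(e - 2))) ^ (mψ - jc - cν) *
        ∫ y in primePowBall F (mψ - jc - cν) \ primePowBall F (mψ - jc - cν + 1),
          ((ψ (c * y)) : ℂ) * Function.extend ((↑) : Fˣ → F) (fun u => ((ν u : ℂˣ) : ℂ)) 0 y ∂μ ≠ 0 :=
  mul_ne_zero (mul_ne_zero hC₀ (zpow_ne_zero _ (Complex.cpow_ne_zero_iff.2 (Or.inl (Nat.cast_ne_zero.2 (residueFieldCard_ne_zero F))))))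
    (gaussIntegral_shell_ne_zero μ ν hc1 hνc hνmin hψ hmψ hc)

end Summit.HodgeConjecture.HodgeConjecture.Cruxes.HLiu418.K2LiuTwistedGammaFactorLetterRamified

end
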